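import Summits.CriticalPhenomena.PercolationContinuityZ3.Theorems.SahiMasterFamilyCommonPivotalTight
import Summits.CriticalPhenomena.PercolationContinuityZ3.Theorems.SahiMasterFamilyPrincipalCapC3
import Summits.CriticalPhenomena.PercolationContinuityZ3.Theorems.SahiMasterFamilyTerminalPositive
import Summits.CriticalPhenomena.PercolationContinuityZ3.Theorems.SahiMasterFamilyHeredity

/-!
# Kahn's Conjecture 5 holds for every FACE-VANISHING triple

Unit `prim-masterthm-p4` (gen 12; crux anchor stmt-CriticalPhenomena-4575, helper work; memo
`run/shared/lean/prim/prim-masterthm/prim-masterthm-p4/P4-GEN12-REPORT.md`).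

A triple of increasing events `U` determined by `S` is FACE-VANISHING if every one-coordinate minor (deletion / contraction at each `e ∈ S`)
is a zero flag (`Z_3`, equivalently has `E₃ ≡ 0`).  **`sahiE_three_nonneg_of_faceVanishing`**: every face-vanishing triple has
`E₃(μ_p; 1_U) ≥ 0` for EVERY `p ∈ [0,1]^ι` — Kahn's Conjecture 5 / Sahi's `C₃` on product measures, on this class.  Cases:
* an independent pair: Harris (`sahiE_three_ind_nonneg_of_indepPair`);
* pairwise dependent with a common pivotal coordinate: the triple is TIGHT (`faceVanishingCommonPivotalTight_holds`, this unit), and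
  principal-cap triples satisfy `C₃` (`PrincipalCapC3.sahiE_three_ind_nonneg_of_principalCap`, this unit) —
  `sahiE_three_nonneg_of_commonPivotal_faceVanishing`;
* pairwise dependent without a common pivotal coordinate (TERMINAL): prim-master-conj's terminal analysis (triangle or a pure event), both
  endings being everywhere-non-negative strata (prim-masterthm-p5's thin-edge theorem; Sahi's principal stratum) — `terminal_core_nonneg`,
  a verbatim re-run of gen 11's `terminal_core_pos` with the sign conclusion for all `p` (`sahiE_three_nonneg_of_terminal`).
HONEST FRAMING: Kahn's Conjecture 5 / `C₃` in general (triples with a minor outside `Z_3`) and `C_k` remain OPEN.  Axioms standard. [this work]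
-/

noncomputable section

open scoped Classical

namespace Summit.CriticalPhenomena.PercolationContinuityZ3.Theorems

open Finset Function
open Literature.Combinatorics.Sahi2008
open Literature.Probability.Percolation (DeterminedBy determinedBy_iff)
open Literature.Probability.Percolation.DecisionTree (ind ind_of_mem ind_of_not_mem ind_nonneg)
open Literature.Probability.LatticeModels.Kahn2022 (Affects)

/-! ### The terminal class, with the sign, at every `p` -/

/-- **The triangle has `E₃ ≥ 0` everywhere** (thin-edge class-T triple; prim-masterthm-p5's stratum). [this work] -/
theorem sahiE_three_nonneg_of_triangle {ι : Type} [Fintype ι] {U : Fin 3 → Set (Set ι)} (hU : ∀ j, IsUpperSet (U j))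
    (hpair : ∀ a b : Fin 3, a ≠ b → (esupp (U a) ∩ esupp (U b)).Nonempty)
    (hT : SahiHybrid.IsClassT fun i => esupp (U i))
    (htri : ∀ j, ∃ x y : ι, x ≠ y ∧ U j = orPair x y ∧ esupp (U j) = {x, y}) :
    ∀ p : ι → unitInterval, 0 ≤ sahiE (bernoulliWeight p) 3 (fun j => ind (U j)) := by
  -- thin edge: `esupp (U 0) ∩ esupp (U 1)` has at most one element
  have hthin : (esupp (U 0) ∩ esupp (U 1)).card ≤ 1 := by
    by_contra hlt
    push Not at hlt
    obtain ⟨x, y, hxy, -, h0⟩ := htri 0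
    have hcard0 : (esupp (U 0)).card = 2 := by rw [h0]; exact card_pair hxy
    have hsub : esupp (U 0) ∩ esupp (U 1) = esupp (U 0) :=
      eq_of_subset_of_card_le inter_subset_left (by rw [hcard0]; omega)
    have h01 : esupp (U 0) ⊆ esupp (U 1) := by rw [← hsub]; exact inter_subset_right
    obtain ⟨e, he⟩ := hpair 0 2 (by decide)
    exact hT e ⟨(mem_inter.1 he).1, h01 (mem_inter.1 he).1, (mem_inter.1 he).2⟩
  exact fun p => SahiHybrid.sahiE_three_nonneg_thinEdge' U hU hT hthin p

/-- **Terminal triples have `E₃(μ_p) ≥ 0` for EVERY `p`** — gen 11's `terminal_core_pos` re-run with the everywhere-sign endings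
(the triangle: thin-edge class T; a pure event: a cylinder, Sahi's principal stratum). [this work] -/
theorem terminal_core_nonneg {ι : Type} [Fintype ι] {A B C : Set (Set ι)}
    (hA : IsUpperSet A) (hB : IsUpperSet B) (hC : IsUpperSet C)
    (hAB : (esupp A ∩ esupp B).Nonempty) (hAC : (esupp A ∩ esupp C).Nonempty) (hBC : (esupp B ∩ esupp C).Nonempty)
    (hprivA : esupp A ⊆ esupp B ∪ esupp C) (hprivB : esupp B ⊆ esupp A ∪ esupp C)
    (hprivC : esupp C ⊆ esupp A ∪ esupp B) (hcommon : ∀ i, i ∈ esupp A → i ∈ esupp B → i ∉ esupp C)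
    (hmin : ∀ i ∈ esupp A ∪ esupp B ∪ esupp C, ∀ b : Bool, SuppZeroFlag 3 ![secAt i b A, secAt i b B, secAt i b C]) :
    ∀ p : ι → unitInterval, 0 ≤ sahiE (bernoulliWeight p) 3 (fun j => ind ((![A, B, C] : Fin 3 → Set (Set ι)) j)) := by
  -- basic facts
  have hU : ∀ j, IsUpperSet ((![A, B, C] : Fin 3 → Set (Set ι)) j) := by
    intro j; fin_cases j <;> assumption
  have hBA : (esupp B ∩ esupp A).Nonempty := by rwa [inter_comm]
  have hCA : (esupp C ∩ esupp A).Nonempty := by rwa [inter_comm]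
  have hCB : (esupp C ∩ esupp B).Nonempty := by rwa [inter_comm]
  have hpair : ∀ a b : Fin 3, a ≠ b →
      (esupp ((![A, B, C] : Fin 3 → Set (Set ι)) a) ∩ esupp ((![A, B, C] : Fin 3 → Set (Set ι)) b)).Nonempty := by
    intro a b hab
    fin_cases a <;> fin_cases b <;> first | exact absurd rfl hab | assumption
  have hAne : A.Nonempty := by obtain ⟨i, hi⟩ := hAB; exact (nonempty_of_esupp_nonempty ⟨i, (mem_inter.1 hi).1⟩).1
  have hBne : B.Nonempty := by obtain ⟨i, hi⟩ := hAB; exact (nonempty_of_esupp_nonempty ⟨i, (mem_inter.1 hi).2⟩).1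
  have hCne : C.Nonempty := by obtain ⟨i, hi⟩ := hAC; exact (nonempty_of_esupp_nonempty ⟨i, (mem_inter.1 hi).2⟩).1
  -- permuted forms of `hcommon`, `hpriv`, `hmin`
  have hcACB : ∀ i, i ∈ esupp A → i ∈ esupp C → i ∉ esupp B := fun i hA' hC' hB' => hcommon i hA' hB' hC'
  have hcBAC : ∀ i, i ∈ esupp B → i ∈ esupp A → i ∉ esupp C := fun i hB' hA' => hcommon i hA' hB'
  have hcBCA : ∀ i, i ∈ esupp B → i ∈ esupp C → i ∉ esupp A := fun i hB' hC' hA' => hcommon i hA' hB' hC'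
  have hcCAB : ∀ i, i ∈ esupp C → i ∈ esupp A → i ∉ esupp B := fun i hC' hA' hB' => hcommon i hA' hB' hC'
  have hcCBA : ∀ i, i ∈ esupp C → i ∈ esupp B → i ∉ esupp A := fun i hC' hB' hA' => hcommon i hA' hB' hC'
  have hpA' : esupp A ⊆ esupp C ∪ esupp B := by rwa [union_comm]
  have hpB' : esupp B ⊆ esupp C ∪ esupp A := by rwa [union_comm]
  have hpC' : esupp C ⊆ esupp B ∪ esupp A := by rwa [union_comm]
  have up : ∀ (X : Set (Set ι)) (i : ι) (b : Bool), IsUpperSet X → IsUpperSet (secAt i b X) :=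
    fun X i b h => isUpperSet_secAt i b h
  have memW : ∀ {i : ι} {P Q R : Finset ι}, i ∈ P ∪ Q ∪ R → i ∈ Q ∪ P ∪ R ∧ i ∈ P ∪ R ∪ Q ∧ i ∈ R ∪ P ∪ Q ∧
      i ∈ Q ∪ R ∪ P ∧ i ∈ R ∪ Q ∪ P := by
    intro i P Q R h; simp only [mem_union] at h ⊢; tauto
  have hmBAC : ∀ i ∈ esupp B ∪ esupp A ∪ esupp C, ∀ b : Bool,
      SuppZeroFlag 3 ![secAt i b B, secAt i b A, secAt i b C] := fun i hi b =>
    (suppZeroFlag_three_swap12 (up A i b hA) (up B i b hB) (up C i b hC)).1 (hmin i (memW hi).1 b)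
  have hmACB : ∀ i ∈ esupp A ∪ esupp C ∪ esupp B, ∀ b : Bool,
      SuppZeroFlag 3 ![secAt i b A, secAt i b C, secAt i b B] := fun i hi b =>
    (suppZeroFlag_three_swap23 (up A i b hA) (up B i b hB) (up C i b hC)).1 (hmin i (memW hi).2.1 b)
  have hmCAB : ∀ i ∈ esupp C ∪ esupp A ∪ esupp B, ∀ b : Bool,
      SuppZeroFlag 3 ![secAt i b C, secAt i b A, secAt i b B] := fun i hi b =>
    (suppZeroFlag_three_swap12 (up A i b hA) (up C i b hC) (up B i b hB)).1 (hmACB i (memW hi).1 b)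
  have hmBCA : ∀ i ∈ esupp B ∪ esupp C ∪ esupp A, ∀ b : Bool,
      SuppZeroFlag 3 ![secAt i b B, secAt i b C, secAt i b A] := fun i hi b =>
    (suppZeroFlag_three_swap23 (up B i b hB) (up A i b hA) (up C i b hC)).1 (hmBAC i (memW hi).2.1 b)
  have hmCBA : ∀ i ∈ esupp C ∪ esupp B ∪ esupp A, ∀ b : Bool,
      SuppZeroFlag 3 ![secAt i b C, secAt i b B, secAt i b A] := fun i hi b =>
    (suppZeroFlag_three_swap12 (up B i b hB) (up C i b hC) (up A i b hA)).1 (hmBCA i (memW hi).1 b)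
  by_cases hsat : (∃ f ∈ esupp A, secAt f true A = Set.univ) ∨ (∃ f ∈ esupp B, secAt f true B = Set.univ) ∨
      (∃ f ∈ esupp C, secAt f true C = Set.univ)
  · -- THE TRIANGLE
    have hclassT : SahiHybrid.IsClassT fun i => esupp ((![A, B, C] : Fin 3 → Set (Set ι)) i) := by
      rintro i ⟨h0, h1, h2⟩
      exact hcommon i h0 h1 h2
    apply sahiE_three_nonneg_of_triangle hU hpair hclassT
    rcases hsat with ⟨f, hf, hs⟩ | ⟨f, hf, hs⟩ | ⟨f, hf, hs⟩
    · rcases mem_union.1 (hprivA hf) with hf' | hf'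
      · obtain ⟨s, t, eA, eB, eC, qA, qB, qC⟩ :=
          triangle_of_saturation hA hB hC hAC hBC hprivA hprivB hprivC hcommon hmin hf hf' hs
        have hfs : f ≠ s := fun h => hcommon f hf hf' (by rw [eC, h]; simp)
        have hft : f ≠ t := fun h => hcommon f hf hf' (by rw [eC, h]; simp)
        have hst : s ≠ t := fun h => hcommon s (by rw [eA]; simp) (by rw [eB, h]; simp) (by rw [eC]; simp)
        intro j; fin_cases j
        · exact ⟨f, s, hfs, qA, eA⟩
        · exact ⟨f, t, hft, qB, eB⟩
        · exact ⟨s, t, hst, qC, eC⟩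
      · obtain ⟨s, t, eA, eC, eB, qA, qC, qB⟩ :=
          triangle_of_saturation hA hC hB hAB hCB hpA' hprivC hprivB hcACB hmACB hf hf' hs
        have hfs : f ≠ s := fun h => hcACB f hf hf' (by rw [eB, h]; simp)
        have hft : f ≠ t := fun h => hcACB f hf hf' (by rw [eB, h]; simp)
        have hst : s ≠ t := fun h => hcACB s (by rw [eA]; simp) (by rw [eC, h]; simp) (by rw [eB]; simp)
        intro j; fin_cases j
        · exact ⟨f, s, hfs, qA, eA⟩
        · exact ⟨s, t, hst, qB, eB⟩
        · exact ⟨f, t, hft, qC, eC⟩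
    · rcases mem_union.1 (hprivB hf) with hf' | hf'
      · obtain ⟨s, t, eB, eA, eC, qB, qA, qC⟩ :=
          triangle_of_saturation hB hA hC hBC hAC hprivB hprivA hpC' hcBAC hmBAC hf hf' hs
        have hfs : f ≠ s := fun h => hcBAC f hf hf' (by rw [eC, h]; simp)
        have hft : f ≠ t := fun h => hcBAC f hf hf' (by rw [eC, h]; simp)
        have hst : s ≠ t := fun h => hcBAC s (by rw [eB]; simp) (by rw [eA, h]; simp) (by rw [eC]; simp)
        intro j; fin_cases j
        · exact ⟨f, t, hft, qA, eA⟩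
        · exact ⟨f, s, hfs, qB, eB⟩
        · exact ⟨s, t, hst, qC, eC⟩
      · obtain ⟨s, t, eB, eC, eA, qB, qC, qA⟩ :=
          triangle_of_saturation hB hC hA hBA hCA hpB' hpC' hprivA hcBCA hmBCA hf hf' hs
        have hfs : f ≠ s := fun h => hcBCA f hf hf' (by rw [eA, h]; simp)
        have hft : f ≠ t := fun h => hcBCA f hf hf' (by rw [eA, h]; simp)
        have hst : s ≠ t := fun h => hcBCA s (by rw [eB]; simp) (by rw [eC, h]; simp) (by rw [eA]; simp)
        intro j; fin_cases j
        · exact ⟨s, t, hst, qA, eA⟩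
        · exact ⟨f, s, hfs, qB, eB⟩
        · exact ⟨f, t, hft, qC, eC⟩
    · rcases mem_union.1 (hprivC hf) with hf' | hf'
      · obtain ⟨s, t, eC, eA, eB, qC, qA, qB⟩ :=
          triangle_of_saturation hC hA hB hCB hAB hprivC hpA' hpB' hcCAB hmCAB hf hf' hs
        have hfs : f ≠ s := fun h => hcCAB f hf hf' (by rw [eB, h]; simp)
        have hft : f ≠ t := fun h => hcCAB f hf hf' (by rw [eB, h]; simp)
        have hst : s ≠ t := fun h => hcCAB s (by rw [eC]; simp) (by rw [eA, h]; simp) (by rw [eB]; simp)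
        intro j; fin_cases j
        · exact ⟨f, t, hft, qA, eA⟩
        · exact ⟨s, t, hst, qB, eB⟩
        · exact ⟨f, s, hfs, qC, eC⟩
      · obtain ⟨s, t, eC, eB, eA, qC, qB, qA⟩ :=
          triangle_of_saturation hC hB hA hCA hBA hpC' hpB' hpA' hcCBA hmCBA hf hf' hs
        have hfs : f ≠ s := fun h => hcCBA f hf hf' (by rw [eA, h]; simp)
        have hft : f ≠ t := fun h => hcCBA f hf hf' (by rw [eA, h]; simp)
        have hst : s ≠ t := fun h => hcCBA s (by rw [eC]; simp) (by rw [eB, h]; simp) (by rw [eA]; simp)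
        intro j; fin_cases j
        · exact ⟨s, t, hst, qA, eA⟩
        · exact ⟨f, t, hft, qB, eB⟩
        · exact ⟨f, s, hfs, qC, eC⟩
  · -- NO SATURATION: a pure event exists, and pure events are cylinders
    simp only [not_or, not_exists, not_and] at hsat
    obtain ⟨nsA, nsB, nsC⟩ := hsat
    have hNSA : ∀ s ∈ esupp A, ({s} : Set ι) ∉ A := fun s hs h => nsA s hs ((secAt_true_eq_univ_iff' hA s).2 h)
    have hNSB : ∀ s ∈ esupp B, ({s} : Set ι) ∉ B := fun s hs h => nsB s hs ((secAt_true_eq_univ_iff' hB s).2 h)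
    have hNSC : ∀ s ∈ esupp C, ({s} : Set ι) ∉ C := fun s hs h => nsC s hs ((secAt_true_eq_univ_iff' hC s).2 h)
    have hpure : (∀ f ∈ esupp A, secAt f false A = ∅) ∨ (∀ f ∈ esupp B, secAt f false B = ∅) ∨
        (∀ f ∈ esupp C, secAt f false C = ∅) := by
      by_cases hN0AB : ∃ e ∈ esupp A ∩ esupp B, Set.univ \ {e} ∈ A ∧ Set.univ \ {e} ∈ B
      · obtain ⟨e, he, h1, h2⟩ := hN0AB
        exact Or.inr (Or.inr (lemma_L3 hA hB hC hAB hAC hBC hprivA hprivB hprivC hcommon hNSA hNSB hNSC hmin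
          (mem_inter.1 he).1 (mem_inter.1 he).2 h1 h2))
      by_cases hN0AC : ∃ e ∈ esupp A ∩ esupp C, Set.univ \ {e} ∈ A ∧ Set.univ \ {e} ∈ C
      · obtain ⟨e, he, h1, h2⟩ := hN0AC
        exact Or.inr (Or.inl (lemma_L3 hA hC hB hAC hAB hCB hpA' hprivC hprivB hcACB hNSA hNSC hNSB hmACB
          (mem_inter.1 he).1 (mem_inter.1 he).2 h1 h2))
      by_cases hN0BC : ∃ e ∈ esupp B ∩ esupp C, Set.univ \ {e} ∈ B ∧ Set.univ \ {e} ∈ C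
      · obtain ⟨e, he, h1, h2⟩ := hN0BC
        exact Or.inl (lemma_L3 hB hC hA hBC hBA hCA hpB' hpC' hprivA hcBCA hNSB hNSC hNSA hmBCA
          (mem_inter.1 he).1 (mem_inter.1 he).2 h1 h2)
      -- every shared coordinate is mandatory for exactly one of its events
      have gtype : ∀ {X Y Z : Set (Set ι)}, IsUpperSet X → IsUpperSet Y → IsUpperSet Z →
          X.Nonempty → Y.Nonempty → Z.Nonempty → (esupp X ∩ esupp Z).Nonempty →
          (∀ i, i ∈ esupp X → i ∈ esupp Y → i ∉ esupp Z) → (∀ i, i ∈ esupp X → i ∈ esupp Z → i ∉ esupp Y) →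
          (∀ i ∈ esupp X ∪ esupp Y ∪ esupp Z, ∀ b : Bool, SuppZeroFlag 3 ![secAt i b X, secAt i b Y, secAt i b Z]) →
          (¬ ∃ e ∈ esupp X ∩ esupp Y, Set.univ \ {e} ∈ X ∧ Set.univ \ {e} ∈ Y) →
          ∀ f, f ∈ esupp X → f ∈ esupp Y → (secAt f false X = ∅ ↔ secAt f false Y ≠ ∅) := by
        intro X Y Z hX hY hZ hXne hYne hZne hXZ hcXYZ hcXZY hm hN0 f hfX hfY
        constructor
        · intro hmX hmY
          obtain ⟨s, hs⟩ := hXZ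
          have hsX := (mem_inter.1 hs).1
          have hsZ := (mem_inter.1 hs).2
          have hse : s ≠ f := fun h => hcXYZ f hfX hfY (h ▸ hsZ)
          exact lemma_L2 hX hY hZ hXne hYne hZne hse hfY (hcXYZ f hfX hfY) (hcXZY s hsX hsZ) hmX hmY
            (hm s (by simp [hsX]) true)
        · intro hmY
          by_contra hmX
          refine hN0 ⟨f, mem_inter.2 ⟨hfX, hfY⟩, ?_, ?_⟩
          · by_contra h; exact hmX ((secAt_false_eq_empty_iff hX f).2 h)
          · by_contra h; exact hmY ((secAt_false_eq_empty_iff hY f).2 h)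
      have hGAB := gtype hA hB hC hAne hBne hCne hAC hcommon hcACB hmin hN0AB
      have hGAC := gtype hA hC hB hAne hCne hBne hAB hcACB hcommon hmACB hN0AC
      have hGBC := gtype hB hC hA hBne hCne hAne hBA hcBCA hcBAC hmBCA hN0BC
      exact stepA hA hB hC hAne hBne hCne hAB hAC hBC hprivA hprivB hprivC hcommon (fun i hi => hmin i hi true)
        hGAB hGAC hGBC
    -- a pure event is a cylinder; cylinders settle (EQ-3)
    intro p
    rcases hpure with h | h | h
    · exact sahiE_three_ind_nonneg_of_principal p _ hU 0 _ (eq_cylinder_of_pure hA hAne h)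
    · exact sahiE_three_ind_nonneg_of_principal p _ hU 1 _ (eq_cylinder_of_pure hB hBne h)
    · exact sahiE_three_ind_nonneg_of_principal p _ hU 2 _ (eq_cylinder_of_pure hC hCne h)

/-- **`C₃` on the terminal class**: every terminal triple of increasing events (pairwise dependent, no common pivotal coordinate, all
minors zero flags) has `E₃(μ_p) ≥ 0` for every `p`. [this work] -/
theorem sahiE_three_nonneg_of_terminal {ι : Type} [Fintype ι] (U : Fin 3 → Set (Set ι)) (S : Finset ι)
    (hU : ∀ j, IsUpperSet (U j)) (hUS : ∀ j, DeterminedBy (U j) (↑S : Set ι)) (hT : TerminalTriple U S) :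
    ∀ p : ι → unitInterval, 0 ≤ sahiE (bernoulliWeight p) 3 (fun j => ind (U j)) := by
  obtain ⟨hPD, hnc, hmin⟩ := hT
  have hT' : TerminalTriple U S := ⟨hPD, hnc, hmin⟩
  -- pairwise-intersecting essential supports
  have hdep : ∀ {X Y : Set (Set ι)}, IsUpperSet X → IsUpperSet Y → ¬ SuppZeroFlag 2 ![X, Y] →
      (esupp X ∩ esupp Y).Nonempty := by
    intro X Y hX hY h
    by_contra hne
    rw [Finset.not_nonempty_iff_eq_empty] at hne
    exact h ((suppZeroFlag_two_iff hX hY).2 (Finset.disjoint_iff_inter_eq_empty.2 hne))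
  have e12 : (fun j : Fin 2 => U ((0 : Fin 3).succAbove j)) = ![U 1, U 2] := by funext j; fin_cases j <;> rfl
  have e02 : (fun j : Fin 2 => U ((1 : Fin 3).succAbove j)) = ![U 0, U 2] := by funext j; fin_cases j <;> rfl
  have e01 : (fun j : Fin 2 => U ((2 : Fin 3).succAbove j)) = ![U 0, U 1] := by funext j; fin_cases j <;> rfl
  have h12 := hPD 0; rw [e12] at h12
  have h02 := hPD 1; rw [e02] at h02
  have h01 := hPD 2; rw [e01] at h01
  have hAB := hdep (hU 0) (hU 1) h01
  have hAC := hdep (hU 0) (hU 2) h02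
  have hBC := hdep (hU 1) (hU 2) h12
  -- no common coordinate
  have hcommon : ∀ i, i ∈ esupp (U 0) → i ∈ esupp (U 1) → i ∉ esupp (U 2) := by
    intro i h0 h1 h2
    refine hnc ⟨i, fun j => ?_⟩
    have hj : Affects (U j) i := by
      fin_cases j
      · exact mem_esupp.1 h0
      · exact mem_esupp.1 h1
      · exact mem_esupp.1 h2
    obtain ⟨ω, hω, hiω⟩ := hj
    exact ⟨ω, fun hi => hω (by rwa [Set.insert_eq_of_mem hi] at hiω), hω, hiω⟩
  -- all minors, in matrix form
  have hsec : ∀ (e : ι) (b : Bool), (fun j => secAt e b (U j)) = ![secAt e b (U 0), secAt e b (U 1), secAt e b (U 2)] := by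
    intro e b; funext j; fin_cases j <;> rfl
  have hminW : ∀ i ∈ esupp (U 0) ∪ esupp (U 1) ∪ esupp (U 2), ∀ b : Bool,
      SuppZeroFlag 3 ![secAt i b (U 0), secAt i b (U 1), secAt i b (U 2)] := by
    intro i hi b
    have hiS : i ∈ S := by
      simp only [mem_union] at hi
      rcases hi with (hi | hi) | hi
      · exact esupp_subset_of_determinedBy (hUS 0) hi
      · exact esupp_subset_of_determinedBy (hUS 1) hi
      · exact esupp_subset_of_determinedBy (hUS 2) hi
    have := hmin i hiS b
    rwa [hsec] at this
  -- no private coordinate (Lemma P, three slots)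
  have hprivA : esupp (U 0) ⊆ esupp (U 1) ∪ esupp (U 2) := esupp_subset_union_of_terminal hU hUS hT'
  have up : ∀ (j : Fin 3) (i : ι) (b : Bool), IsUpperSet (secAt i b (U j)) := fun j i b => isUpperSet_secAt i b (hU j)
  have hprivB : esupp (U 1) ⊆ esupp (U 0) ∪ esupp (U 2) := by
    intro e he
    by_contra hnot
    rw [mem_union, not_or] at hnot
    have heS : e ∈ S := esupp_subset_of_determinedBy (hUS 1) he
    have hmin' : ∀ b : Bool, SuppZeroFlag 3 ![secAt e b (U 1), U 0, U 2] := by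
      intro b
      have h := hmin e heS b
      rw [hsec, secAt_eq_self_of_not_affects (hU 0) (fun h' => hnot.1 (mem_esupp.2 h')) b,
        secAt_eq_self_of_not_affects (hU 2) (fun h' => hnot.2 (mem_esupp.2 h')) b] at h
      exact (suppZeroFlag_three_swap12 (hU 0) (up 1 e b) (hU 2)).1 h
    exact not_both_minors_zeroFlag (hU 1) (hU 0) (hU 2) (by rwa [inter_comm]) hBC hAC hnot.1 hnot.2
      (hmin' false) (hmin' true)
  have hprivC : esupp (U 2) ⊆ esupp (U 0) ∪ esupp (U 1) := by
    intro e he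
    by_contra hnot
    rw [mem_union, not_or] at hnot
    have heS : e ∈ S := esupp_subset_of_determinedBy (hUS 2) he
    have hmin' : ∀ b : Bool, SuppZeroFlag 3 ![secAt e b (U 2), U 0, U 1] := by
      intro b
      have h := hmin e heS b
      rw [hsec, secAt_eq_self_of_not_affects (hU 0) (fun h' => hnot.1 (mem_esupp.2 h')) b,
        secAt_eq_self_of_not_affects (hU 1) (fun h' => hnot.2 (mem_esupp.2 h')) b] at h
      exact (suppZeroFlag_three_swap12 (hU 0) (up 2 e b) (hU 1)).1
        ((suppZeroFlag_three_swap23 (hU 0) (hU 1) (up 2 e b)).1 h)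
    exact not_both_minors_zeroFlag (hU 2) (hU 0) (hU 1) (by rwa [inter_comm]) (by rwa [inter_comm]) hAB hnot.1
      hnot.2 (hmin' false) (hmin' true)
  -- the core
  have hF : (fun j => ind (U j)) = fun j => ind ((![U 0, U 1, U 2] : Fin 3 → Set (Set ι)) j) := by
    funext j; fin_cases j <;> rfl
  rw [hF]
  exact terminal_core_nonneg (hU 0) (hU 1) (hU 2) hAB hAC hBC hprivA hprivB hprivC hcommon hminW

/-! ### Face-vanishing triples -/

/-- **`C₃` on face-vanishing triples with a common pivotal coordinate** (tightness + the principal-cap stratum). [this work] -/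
theorem sahiE_three_nonneg_of_commonPivotal_faceVanishing (ι : Type) [Fintype ι] (p : ι → unitInterval) (U : Fin 3 → Set (Set ι))
    (S : Finset ι) (hU : ∀ j, IsUpperSet (U j)) (hUS : ∀ j, DeterminedBy (U j) (↑S : Set ι))
    (hpiv : ∃ e : ι, ∀ j, ∃ ω, e ∉ ω ∧ ω ∉ U j ∧ insert e ω ∈ U j)
    (hfv : ∀ e ∈ S, ∀ b : Bool, SuppZeroFlag 3 (fun j => secAt e b (U j))) :
    0 ≤ sahiE (bernoulliWeight p) 3 (fun j => ind (U j)) := by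
  obtain ⟨c, hc⟩ := PositiveSomewhere.faceVanishingCommonPivotalTight_holds ι U S hU hUS hpiv hfv
  exact PrincipalCapC3.sahiE_three_ind_nonneg_of_principalCap p U hU c hc

/-- **Kahn's Conjecture 5 holds for every face-vanishing triple**: three increasing events determined by `S`, all of whose minors at
coordinates of `S` are zero flags, have `E₃(μ_p; 1_{U₀},1_{U₁},1_{U₂}) ≥ 0` for EVERY `p ∈ [0,1]^ι`. [this work] -/
theorem sahiE_three_nonneg_of_faceVanishing (ι : Type) [Fintype ι] (p : ι → unitInterval) (U : Fin 3 → Set (Set ι))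
    (S : Finset ι) (hU : ∀ j, IsUpperSet (U j)) (hUS : ∀ j, DeterminedBy (U j) (↑S : Set ι))
    (hfv : ∀ e ∈ S, ∀ b : Bool, SuppZeroFlag 3 (fun j => secAt e b (U j))) :
    0 ≤ sahiE (bernoulliWeight p) 3 (fun j => ind (U j)) := by
  by_cases hPD : PairwiseDependent U
  · by_cases hpiv : ∃ e : ι, ∀ j, ∃ ω, e ∉ ω ∧ ω ∉ U j ∧ insert e ω ∈ U j
    · exact sahiE_three_nonneg_of_commonPivotal_faceVanishing ι p U S hU hUS hpiv hfv
    · exact sahiE_three_nonneg_of_terminal U S hU hUS ⟨hPD, hpiv, hfv⟩ p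
  · unfold PairwiseDependent at hPD
    push Not at hPD
    obtain ⟨m, hm⟩ := hPD
    exact sahiE_three_ind_nonneg_of_indepPair p U hU m hm

end Summit.CriticalPhenomena.PercolationContinuityZ3.Theorems
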